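import Summits.QuantumFields.YangMills.Theorems.BalabanUVNodesN13UVRowDepthIndexedAtRecord13
import Summits.QuantumFields.YangMills.Theorems.BalabanUVNodesN13Cor3AtRecordOfU1U2L2SmallLocus

/-!
# BalabanUVNodes ∕ N13 — [III] COR. 3 AND K1⁷'s (B) CONJUNCT AT THE `SepCoPH` RECORD FROM THEOREM 1 + (U1) + (U2) + (L2ˢ) WITH DEPTH-INDEXED BUDGETS:
# the N13 leaves may carry constants depending on the coupling value AND the remaining depth `K − k` (equivalently `|T₁^{(k)}|`), under the WORLD's lower β-box

Cell `pub-ymgap` (HUMAN RULING D-0062 Track A; D-0149 width seat `pub-ymgap-dag-n13-w1`, g3, CLAIM-2), key K1⁷ `StabilityBAtRecordR13SepCoPH` = stmt-QuantumFields-20542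
(`--kind proof --supports … --as helper`).  [III] = [Balaban1988Convergent], [B16] = [Balaban1989LargeFieldII], [I] = [Balaban1987RG1], [Av] = [Balaban1985Averaging].

WHY THIS FILE.  dag-n13-w3 (p592785 ∕ p594664) and dag-n13-w1 g2 (p597863 ∕ p597573) priced N13's (UV₁₃) row — K1⁷'s Cor-3 conjunct at the record and the engines' `hUV`
binder — at exactly THREE displayed leaves on the record's own (2.18) representation: (U1) termwise majorants `χ_s·TexpA_s ≤ major s`, (U2) the sum budget
`Σ_s major s ≤ exp(ep(g_k)|T₁^{(k)}|)` ([6] (3.42)'s transfer, GAPS G-adv3-1), (L2ˢ) the all-small term's lower bound `χβ·exp(−g_k⁻²A − em(g_k)|T|) ≤ χ_{s₀}·TexpA_{s₀}` on the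
small locus ([III] Thm 2 (2.49) at the record, G-adv3-2) — with budgets `em(g_k)`, `ep(g_k)` depending on the COUPLING VALUE ONLY, as [III] Cor. 3's dependence clause reads.
CLAIM-1 (`…N13UVRowDepthIndexedAtRecord13`, p600126) showed that along a windowed run with the WORLD's lower β-box `BetaLowerH b γ β₁₃(θ)`, `0 < b`, (0.20) bounds the
remaining depth, `(K − k)·b < g_k⁻²`, so two-sided bounds with constants indexed by `(g_k, K − k)` already give the coupling-indexed reading.  THIS FILE re-prices the three
leaves accordingly: (U2) and (L2ˢ) may be delivered with budgets `Ep(g_k, K−k)`, `Em(g_k, K−k)` — ANY dependence on the remaining depth, hence on the volume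
`|T₁^{(k)}| = (2L^{m+K−k})⁴` — and K1⁷'s (B) at its own `SepCoPH` record still follows from Theorem 1 at the record; likewise the engines' `hUV` binder in a world `w` with its
own `hlo`.  dag-n13-w1 g2's p597863 ∕ p597573 are the depth-blind special cases.

WHAT THIS FILE PROVES (3 theorems, 0 `def`): `cor3With_datumOfRecord₁₃SepCoPH_of_U1_U2_L2small_depthIndexed` · ★★★ `endStatementBPrinted_datumOfRecord₁₃SepCoPH_of_thm1_of_U1_U2_L2small_depthIndexed` ·
★★ `hUV₁₃CoPH_of_U1_U2_L2small_depthIndexed`.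

HONEST FRAMING.  Count-neutral by-name composition (p597863 `uvIneq_at_record₁₃CoPH_of_U1_U2_L2small`, p592785 `sLaw₁₃CoPH_of_thm1`, n24-c's `uvIneq_at_record₁₃CoPH_iff`, CLAIM-1's
`cor3With_datumOfRecord₁₃SepCoPH_of_depthIndexed` ∕ `exists_dominating_of_depthBound` ∕ `hUV₁₃_of_depthIndexed`, adv3's `inInterval_of_le`, `FlowStep.box_mono`); the side conditions on
`εreg` ([Av] Prop. 2's range) are p597863's; `b > 0` is NODE O's unprinted lower β-box (DAG leaf `betaPositive`, T09.F), DISPLAYED; Theorem 1 at the record and the three leaves are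
DISPLAYED — nothing of [B16] Thm 1 ∕ [III] Cor. 3 ∕ Thm 2 claimed; N13 NOT discharged; K0⁷∕K1⁷ NOT closed; counts unmoved (5∕27 · A 5∕28); one finite `𝕋⁴_{L^K}` programme at
fixed `ε = L^{−K}` — R4 closes the conditional finite-𝕋⁴ rung `BalabanLadder.UV` only; the YM mass gap (Clay) is NOT proved by any of this.  No `def`, no `sorry`, no `instance`.
-/

noncomputable section

open scoped BigOperators Matrix.Norms.L2Operator

namespace Summit.QuantumFields.YangMills.BalabanUVNodes.N13Cor3AtRecordOfDepthIndexedLeaves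

open Literature.MathematicalPhysics.QuantumFieldTheory.Balaban1983to89
open Literature.MathematicalPhysics.QuantumFieldTheory.Balaban1983to89.T4Continuum (T4Family)
open Literature.MathematicalPhysics.QuantumFieldTheory.Balaban1983to89.Node00
open FlowStep (BetaLowerH)
open FlowStepRuns (genFlow)
open DagBinding (WorldP)
open ExpMeanLog (deltaSU)
open B14Cor3 (inInterval_of_le)
open B16NodeKnitRecord13CoPH (uvIneq_at_record₁₃CoPH_iff)
open Summit.QuantumFields.YangMills.BalabanUVNodes.N13Cor3Repr218LeavesAtRecord13CoPH (sLaw₁₃CoPH_of_thm1)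
open Summit.QuantumFields.YangMills.BalabanUVNodes.N13Cor3AtRecordOfU1U2L2SmallLocus (uvIneq_at_record₁₃CoPH_of_U1_U2_L2small)
open Summit.QuantumFields.YangMills.BalabanUVNodes.N13UVRowDepthIndexedAtRecord13
  (cor3With_datumOfRecord₁₃SepCoPH_of_depthIndexed exists_dominating_of_depthBound hUV₁₃_of_depthIndexed)

variable {F : T4Family} {N : ℕ} [NeZero N] (θ : Stage13HParams F N) (h : θ.Provisos₁₃SepCoPH F N)


/-- **`B16.Cor3With` AT THE `SepCoPH` RECORD ON `]0, γ]` FROM `SLaw` THERE + (U1) + (U2) + (L2ˢ) WITH DEPTH-INDEXED BUDGETS** — dag-n13-w1 g2's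
`cor3With_datumOfRecord₁₃CoPH_of_U1_U2_L2small` (p597863) with the sum budget `Σ_s major s ≤ exp(Ep(g_k, K−k)·|T₁^{(k)}|)` and the all-small term's lower bound read with
`Em(g_k, K−k)` — constants indexed by the coupling value AND the remaining depth — under the lower β-box `BetaLowerH b γ β₁₃(θ)` and any `em, ep` dominating `Em, Ep` on the
qualifying depths `n·b < (x²)⁻¹` (CLAIM-1's `cor3With_datumOfRecord₁₃SepCoPH_of_depthIndexed`; per `(P, k)` the free reals of p597863's `uvIneq_at_record₁₃CoPH_of_U1_U2_L2small` are
instantiated at `E(g_k, K−k)`).  `εreg` in [Av] Prop. 2's range. [cite: Balaban1988Convergent, (2.18) p.257, Cor. 3 (2.50) p.264; Balaban1989LargeFieldII, (0.1) pp.355–356; Balaban1987RG1, (0.20) p.256, (2.9) p.266; Balaban1985Averaging, Prop. 2 (54) p.26] -/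
theorem cor3With_datumOfRecord₁₃SepCoPH_of_U1_U2_L2small_depthIndexed (hε : 0 < θ.ν.εreg) (hε3 : (143 * ((((4 + 4 : ℕ) : ℝ)) ^ 2 / 4) ^ 2) * θ.ν.εreg ≤ 1 / 3)
    (hε2 : 2 * θ.ν.εreg ≤ 2 * deltaSU (Fin N) / ((((4 + 4) * F.L : ℕ) : ℝ) ^ 2)) {γ b : ℝ}
    (hβ : BetaLowerH b γ (betaOfRecord₁₃ F N θ.toStage13Params)) (Em Ep : ℝ → ℕ → ℝ) (em ep : ℝ → ℝ)
    (hem : ∀ x : ℝ, 0 < x → ∀ n : ℕ, (n : ℝ) * b < (x ^ 2)⁻¹ → Em x n ≤ em x)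
    (hep : ∀ x : ℝ, 0 < x → ∀ n : ℕ, (n : ℝ) * b < (x ^ 2)⁻¹ → Ep x n ≤ ep x)
    (major : (P : B12.RunParams) → (k : ℕ) → (reprOfRecord₁₃ F N θ.toStage13Params P k).Adm → ℝ)
    (s₀ : (P : B12.RunParams) → (k : ℕ) → (reprOfRecord₁₃ F N θ.toStage13Params P k).Adm)
    (hS : ∀ P : B12.RunParams, ((datumOfRecord₁₃SepCoPH F N θ h).C P).flow.InInterval γ P.K → ∀ k, k ≤ P.K → SLaw₁₃CoPH F N θ P k)
    (hU1 : ∀ P : B12.RunParams, ((datumOfRecord₁₃SepCoPH F N θ h).C P).flow.InInterval γ P.K → ∀ k, k ≤ P.K → SLaw₁₃CoPH F N θ P k →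
      ∀ s V, (reprOfRecord₁₃ F N θ.toStage13Params P k).χ s V * (reprOfRecord₁₃ F N θ.toStage13Params P k).TexpA s V ≤ major P k s)
    (hU2 : ∀ P : B12.RunParams, ((datumOfRecord₁₃SepCoPH F N θ h).C P).flow.InInterval γ P.K → ∀ k, k ≤ P.K → SLaw₁₃CoPH F N θ P k →
      ∑ s, major P k s ≤ Real.exp (Ep (gOfRecord₁₃ F N θ.toStage13Params P k) (P.K - k) * (Fintype.card (Site (F.P P.K) k) : ℝ)))
    (hL2small : ∀ P : B12.RunParams, ((datumOfRecord₁₃SepCoPH F N θ h).C P).flow.InInterval γ P.K → ∀ k, k ≤ P.K → SLaw₁₃CoPH F N θ P k →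
      ∀ V : GaugeField (F.P P.K) k (SU N),
        (∀ p : Plaq (F.P P.K) k, ¬ IsB0 (F := F) (⟨p.src, p.μ⟩ : PBond (F.P P.K) k) → ¬ IsB0 (F := F) (⟨p.src.shift p.μ, p.ν⟩ : PBond (F.P P.K) k) →
          ¬ IsB0 (F := F) (⟨p.src.shift p.ν, p.μ⟩ : PBond (F.P P.K) k) → ¬ IsB0 (F := F) (⟨p.src, p.ν⟩ : PBond (F.P P.K) k) →
          dist1 (GaugeField.plaqHol V p) < 2 * θ.ν.εreg + 4 * θ.ε₂₉) →
        chiβOfRecord₁₃ F N θ.toStage13Params P.K (gOfRecord₁₃ F N θ.toStage13Params P) k V *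
            Real.exp (-(1 / (gOfRecord₁₃ F N θ.toStage13Params P k) ^ 2 * wilsonBGOfRecord F N θ.εbg P k V)
              - Em (gOfRecord₁₃ F N θ.toStage13Params P k) (P.K - k) * (Fintype.card (Site (F.P P.K) k) : ℝ)) ≤
          (reprOfRecord₁₃ F N θ.toStage13Params P k).χ (s₀ P k) V * (reprOfRecord₁₃ F N θ.toStage13Params P k).TexpA (s₀ P k) V) :
    B16.Cor3With (datumOfRecord₁₃SepCoPH F N θ h).C γ em ep :=
  cor3With_datumOfRecord₁₃SepCoPH_of_depthIndexed θ h hβ Em Ep em ep hem hep fun P hP k hk V =>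
    uvIneq_at_record₁₃CoPH_of_U1_U2_L2small θ h.toCore hε hε3 hε2 P hk (major P k) (s₀ P k) _ _
      (hU1 P hP k hk (hS P hP k hk)) (hU2 P hP k hk (hS P hP k hk)) (hL2small P hP k hk (hS P hP k hk)) V

/-- **★★★ K1⁷'s (B) CONJUNCT AT ITS OWN `SepCoPH` RECORD FROM THEOREM 1 AT THE RECORD + DEPTH-INDEXED (U1) + (U2) + (L2ˢ)** — `B16.EndStatementBPrinted ((datumOfRecord₁₃SepCoPH θ h).C)`
from `Thm1Printed` at the SepCoPH datum (a hypothesis: N11∕N13's 𝐑-row product; it supplies `SLaw` on some `]0, γ₁]` by dag-n13-w3's `sLaw₁₃CoPH_of_thm1`), the three N13 leaves on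
`]0, γ]` with budgets `Ep(g_k, K−k)` ∕ `Em(g_k, K−k)`, the lower β-box `BetaLowerH b γ β₁₃(θ)` with `0 < b` (NODE O's letter; shrunk to `]0, min γ γ₁]` by `FlowStep.box_mono`)
and `0 < γ`; the dependence functions `e±(g_k)` of (2.50) are PRODUCED (`exists_dominating_of_depthBound`).  The most relaxed supplier form of N13's (UV₁₃) row for K1⁷ that
the kernel certifies today.  CONDITIONAL; nothing of Bałaban's asserted; K1⁷ NOT closed (its ∃θ, guard, admissibility and window live elsewhere).
[cite: Balaban1989LargeFieldII, Thm 1 p.355, (0.1) pp.355–356, p.391; Balaban1988Convergent, Cor. 3 (2.50) p.264; Balaban1987RG1, (0.20) p.256; Balaban1985Averaging, Prop. 2 (54) p.26] -/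
theorem endStatementBPrinted_datumOfRecord₁₃SepCoPH_of_thm1_of_U1_U2_L2small_depthIndexed (hε : 0 < θ.ν.εreg)
    (hε3 : (143 * ((((4 + 4 : ℕ) : ℝ)) ^ 2 / 4) ^ 2) * θ.ν.εreg ≤ 1 / 3)
    (hε2 : 2 * θ.ν.εreg ≤ 2 * deltaSU (Fin N) / ((((4 + 4) * F.L : ℕ) : ℝ) ^ 2)) {γ b : ℝ} (hγ : 0 < γ) (hb : 0 < b)
    (hβ : BetaLowerH b γ (betaOfRecord₁₃ F N θ.toStage13Params)) (Em Ep : ℝ → ℕ → ℝ)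
    (major : (P : B12.RunParams) → (k : ℕ) → (reprOfRecord₁₃ F N θ.toStage13Params P k).Adm → ℝ)
    (s₀ : (P : B12.RunParams) → (k : ℕ) → (reprOfRecord₁₃ F N θ.toStage13Params P k).Adm)
    (h1 : B16.Thm1Printed (datumOfRecord₁₃SepCoPH F N θ h).C)
    (hU1 : ∀ P : B12.RunParams, ((datumOfRecord₁₃SepCoPH F N θ h).C P).flow.InInterval γ P.K → ∀ k, k ≤ P.K → SLaw₁₃CoPH F N θ P k →
      ∀ s V, (reprOfRecord₁₃ F N θ.toStage13Params P k).χ s V * (reprOfRecord₁₃ F N θ.toStage13Params P k).TexpA s V ≤ major P k s)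
    (hU2 : ∀ P : B12.RunParams, ((datumOfRecord₁₃SepCoPH F N θ h).C P).flow.InInterval γ P.K → ∀ k, k ≤ P.K → SLaw₁₃CoPH F N θ P k →
      ∑ s, major P k s ≤ Real.exp (Ep (gOfRecord₁₃ F N θ.toStage13Params P k) (P.K - k) * (Fintype.card (Site (F.P P.K) k) : ℝ)))
    (hL2small : ∀ P : B12.RunParams, ((datumOfRecord₁₃SepCoPH F N θ h).C P).flow.InInterval γ P.K → ∀ k, k ≤ P.K → SLaw₁₃CoPH F N θ P k →
      ∀ V : GaugeField (F.P P.K) k (SU N),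
        (∀ p : Plaq (F.P P.K) k, ¬ IsB0 (F := F) (⟨p.src, p.μ⟩ : PBond (F.P P.K) k) → ¬ IsB0 (F := F) (⟨p.src.shift p.μ, p.ν⟩ : PBond (F.P P.K) k) →
          ¬ IsB0 (F := F) (⟨p.src.shift p.ν, p.μ⟩ : PBond (F.P P.K) k) → ¬ IsB0 (F := F) (⟨p.src, p.ν⟩ : PBond (F.P P.K) k) →
          dist1 (GaugeField.plaqHol V p) < 2 * θ.ν.εreg + 4 * θ.ε₂₉) →
        chiβOfRecord₁₃ F N θ.toStage13Params P.K (gOfRecord₁₃ F N θ.toStage13Params P) k V *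
            Real.exp (-(1 / (gOfRecord₁₃ F N θ.toStage13Params P k) ^ 2 * wilsonBGOfRecord F N θ.εbg P k V)
              - Em (gOfRecord₁₃ F N θ.toStage13Params P k) (P.K - k) * (Fintype.card (Site (F.P P.K) k) : ℝ)) ≤
          (reprOfRecord₁₃ F N θ.toStage13Params P k).χ (s₀ P k) V * (reprOfRecord₁₃ F N θ.toStage13Params P k).TexpA (s₀ P k) V) :
    B16.EndStatementBPrinted (datumOfRecord₁₃SepCoPH F N θ h).C := by
  obtain ⟨γ₁, hγ₁, H1⟩ := sLaw₁₃CoPH_of_thm1 F N θ h.toCore h1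
  obtain ⟨em, hem⟩ := exists_dominating_of_depthBound hb Em
  obtain ⟨ep, hep⟩ := exists_dominating_of_depthBound hb Ep
  have hβ' : BetaLowerH b (min γ γ₁) (betaOfRecord₁₃ F N θ.toStage13Params) :=
    fun k v hv => hβ k v (FlowStep.box_mono (min_le_left γ γ₁) k hv)
  refine ⟨h1, min γ γ₁, lt_min hγ hγ₁, em, ep, ?_⟩
  refine cor3With_datumOfRecord₁₃SepCoPH_of_U1_U2_L2small_depthIndexed θ h hε hε3 hε2 hβ' Em Ep em ep hem hep major s₀ ?_ ?_ ?_ ?_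
  · exact fun P hP k hk => H1 P (inInterval_of_le hP (min_le_right γ γ₁)) k hk
  · exact fun P hP => hU1 P (inInterval_of_le hP (min_le_left γ γ₁))
  · exact fun P hP => hU2 P (inInterval_of_le hP (min_le_left γ γ₁))
  · exact fun P hP => hL2small P (inInterval_of_le hP (min_le_left γ γ₁))

/-- **★★ THE ENGINES' `hUV` BINDER FROM DEPTH-INDEXED (U1) + (U2) + (L2ˢ)** — at `θ.toStage13Params` under the CORE provisos `Provisos₁₃CoPH` (the key dag-n12-d's S-bound four-pin
engine reads), in the four-pin world `w : WorldP` with ITS OWN lower β-box `hlo : BetaLowerH w.b w.γ β₁₃(θ)` (`0 < w.b` a field of `WorldP`): termwise majorants (U1), the sum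
budget (U2) with `Ep(g_k, K−k)`, the all-small term's lower bound on the small locus (L2ˢ) with `Em(g_k, K−k)`, and the dominations `E x n ≤ w.e x` on `n·w.b < (x²)⁻¹` give the
`hUV` hypothesis of `nodes₁₃CoPH_upS_fourPinW₀_pointed` ∕ dag-n24-c's closers LETTER FOR LETTER (p597863 per `(P, k)` + n24-c's `uvIneq_at_record₁₃CoPH_iff` + CLAIM-1's
`hUV₁₃_of_depthIndexed`).  dag-n13-w1 g2's `hUV₁₃CoPH_of_U1_U2_L2small` (p597573) is the special case of depth-blind budgets `Em x n := w.em x`, `Ep x n := w.ep x`.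
[cite: Balaban1989LargeFieldII, Thm 1 p.355, (0.1) pp.355–356; Balaban1988Convergent, (2.18) p.257, Cor. 3 (2.50) p.264; Balaban1987RG1, (0.20) p.256, (2.9) p.266; Balaban1985Averaging, Prop. 2 (54) p.26] -/
theorem hUV₁₃CoPH_of_U1_U2_L2small_depthIndexed (hc : θ.Provisos₁₃CoPH F N) (w : WorldP)
    (hε : 0 < θ.ν.εreg) (hε3 : (143 * ((((4 + 4 : ℕ) : ℝ)) ^ 2 / 4) ^ 2) * θ.ν.εreg ≤ 1 / 3)
    (hε2 : 2 * θ.ν.εreg ≤ 2 * deltaSU (Fin N) / ((((4 + 4) * F.L : ℕ) : ℝ) ^ 2))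
    (hlo : BetaLowerH w.b w.γ (betaOfRecord₁₃ F N θ.toStage13Params)) (Em Ep : ℝ → ℕ → ℝ)
    (hem : ∀ x : ℝ, 0 < x → ∀ n : ℕ, (n : ℝ) * w.b < (x ^ 2)⁻¹ → Em x n ≤ w.em x)
    (hep : ∀ x : ℝ, 0 < x → ∀ n : ℕ, (n : ℝ) * w.b < (x ^ 2)⁻¹ → Ep x n ≤ w.ep x)
    (major : (P : B12.RunParams) → (k : ℕ) → (reprOfRecord₁₃ F N θ.toStage13Params P k).Adm → ℝ)
    (s₀ : (P : B12.RunParams) → (k : ℕ) → (reprOfRecord₁₃ F N θ.toStage13Params P k).Adm)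
    (hU1 : ∀ P : B12.RunParams, (genFlow (betaOfRecord₁₃ F N θ.toStage13Params) P.g0).InInterval w.γ P.K → ∀ k, k ≤ P.K → SLaw₁₃CoPH F N θ P k →
      ∀ s V, (reprOfRecord₁₃ F N θ.toStage13Params P k).χ s V * (reprOfRecord₁₃ F N θ.toStage13Params P k).TexpA s V ≤ major P k s)
    (hU2 : ∀ P : B12.RunParams, (genFlow (betaOfRecord₁₃ F N θ.toStage13Params) P.g0).InInterval w.γ P.K → ∀ k, k ≤ P.K → SLaw₁₃CoPH F N θ P k →
      ∑ s, major P k s ≤ Real.exp (Ep (gOfRecord₁₃ F N θ.toStage13Params P k) (P.K - k) * (Fintype.card (Site (F.P P.K) k) : ℝ)))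
    (hL2small : ∀ P : B12.RunParams, (genFlow (betaOfRecord₁₃ F N θ.toStage13Params) P.g0).InInterval w.γ P.K → ∀ k, k ≤ P.K → SLaw₁₃CoPH F N θ P k →
      ∀ V : GaugeField (F.P P.K) k (SU N),
        (∀ p : Plaq (F.P P.K) k, ¬ IsB0 (F := F) (⟨p.src, p.μ⟩ : PBond (F.P P.K) k) → ¬ IsB0 (F := F) (⟨p.src.shift p.μ, p.ν⟩ : PBond (F.P P.K) k) →
          ¬ IsB0 (F := F) (⟨p.src.shift p.ν, p.μ⟩ : PBond (F.P P.K) k) → ¬ IsB0 (F := F) (⟨p.src, p.ν⟩ : PBond (F.P P.K) k) →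
          dist1 (GaugeField.plaqHol V p) < 2 * θ.ν.εreg + 4 * θ.ε₂₉) →
        chiβOfRecord₁₃ F N θ.toStage13Params P.K (gOfRecord₁₃ F N θ.toStage13Params P) k V *
            Real.exp (-(1 / (gOfRecord₁₃ F N θ.toStage13Params P k) ^ 2 * wilsonBGOfRecord F N θ.εbg P k V)
              - Em (gOfRecord₁₃ F N θ.toStage13Params P k) (P.K - k) * (Fintype.card (Site (F.P P.K) k) : ℝ)) ≤
          (reprOfRecord₁₃ F N θ.toStage13Params P k).χ (s₀ P k) V * (reprOfRecord₁₃ F N θ.toStage13Params P k).TexpA (s₀ P k) V) :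
    ∀ P : B12.RunParams, (genFlow (betaOfRecord₁₃ F N θ.toStage13Params) P.g0).InInterval w.γ P.K → ∀ k, k ≤ P.K → SLaw₁₃CoPH F N θ P k →
      ∀ U : GaugeField (F.P P.K) k (SU N),
        chiβOfRecord₁₃ F N θ.toStage13Params P.K (gOfRecord₁₃ F N θ.toStage13Params P) k U *
              Real.exp (-(1 / (gOfRecord₁₃ F N θ.toStage13Params P k) ^ 2 * wilsonBGOfRecord F N θ.toStage13Params.εbg P k U)
                - w.em (gOfRecord₁₃ F N θ.toStage13Params P k) * (Fintype.card (Site (F.P P.K) k) : ℝ)) ≤ densOfRecord₁₃ F N θ.toStage13Params P k U ∧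
        densOfRecord₁₃ F N θ.toStage13Params P k U ≤ Real.exp (w.ep (gOfRecord₁₃ F N θ.toStage13Params P k) * (Fintype.card (Site (F.P P.K) k) : ℝ)) :=
  hUV₁₃_of_depthIndexed θ w hlo Em Ep hem hep fun P hP k hk hS U =>
    (uvIneq_at_record₁₃CoPH_iff F N θ hc P k U _ _).1
      (uvIneq_at_record₁₃CoPH_of_U1_U2_L2small θ hc hε hε3 hε2 P hk (major P k) (s₀ P k) _ _
        (hU1 P hP k hk hS) (hU2 P hP k hk hS) (hL2small P hP k hk hS) U)

end Summit.QuantumFields.YangMills.BalabanUVNodes.N13Cor3AtRecordOfDepthIndexedLeaves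

end
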